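import Mathlib
import Summits.CriticalPhenomena.CardyFormulaZ2.Theorems.CardySelfRefinementDefs
import Summits.CriticalPhenomena.CardyFormulaZ2.Theorems.CardySelfRefinementGradientComparabilityStubDrhoEqSignedSum
import Summits.CriticalPhenomena.CardyFormulaZ2.Theorems.CardySelfRefinementGradientComparabilityStubSlopeBoundsBundle
import Literature.Probability.LatticeModels.ProdBernoulliIndependence
import HarnessLib

/-!
# Crux `GradientComparability` (stmt-CriticalPhenomena-10269), line `monotone-product-coordinates` —
# support for stub `stub_cornerWindows`, part 1: bundle surgery on the coin side and the sections of
# the localised crossing event at a bundle pattern; the Russo term "selector forced ON"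

Route `CardySelfRefinement`, sub-problem `CriticalPhenomena/CardyFormulaZ2`; vocabulary from
`CardySelfRefinementDefs` (`ax tb opn cfg prm M Aloc edgeOf`), bundle combinatorics
(`exists_bundle_param`, `opn_subEdge`) from `…StubSlopeBoundsBundle`.

## Mathematics

Fix the bundle `(t, d)` of `M_k(ρ,c)` with sub-edges `e_j = edgeOf (w j, d)` (`j < k`), `B = {e_j}`.
Its `k + 2` coins — selector `(t,d,2)`, shared coin `(t,d,1)`, own coins `(w j, d, 0)` — are read by
no other edge (`opn_congr_off_bundleCoins`), so a coin sample modified on these coins only reads out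
to `cfg k S` with the bundle replaced by a pattern (`cfg_eq_of_agree_off_bundleCoins`): with the
selector ON every sub-edge copies the shared coin (`cfg_insert_selector_eq`), with the selector OFF
every sub-edge reads its own coin (`cfg_sdiff_selector_eq`).  For `C ⊆ B` the **section**
`A^C = {ω | (ω ∖ B) ∪ C ∈ Aloc}` of the localised joint crossing event, pulled back to the coins,
ignores the bundle coins (`determinedBy_preimage_section_bundle`); independence of disjoint coin
sets under `prodBernoulli` then gives the first Russo term of the selector
(`real_insert_selector_eq_sections`, registered):

`P{S | σ ∪ S ∈ E} = ½ M_k(ρ,c)(ω ∪ B ∈ Aloc) + ½ M_k(ρ,c)(ω ∖ B ∈ Aloc)`, `E = cfg k ⁻¹' Aloc`,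

at EVERY parameter point (`ρ = 1` included).  Part 2 (`…StubCornerWindowsPatterns`) adds the term
"selector forced OFF" (a `2^{-k}`-weighted sum over the `2^k` own-coin patterns), the pattern
formula for the selector influence and `|∂ρP| ≤ (½ − 2^{-k}) Σ_bundles M_k(bundle set-pivotal)`.
(Grimmett 1999 Thm 2.25 / Russo 1981 §4 Lemma 3: Russo's formula and conditioning on a block.)
-/

noncomputable section

namespace Summit.CriticalPhenomena.CardyFormulaZ2.Theorems.CardySelfRefinement

open scoped Topology
open Filter Set MeasureTheory
open Literature.Probability.LatticeModels Literature.Probability.Percolation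
open Literature.Probability.Percolation.QuadCrossing
open Summit.CriticalPhenomena.CardyFormulaZ2.Theses.CardySelfRefinement

/-! ## Bundle surgery: no edge outside the bundle reads the bundle's `k + 2` coins -/

/-- An edge which is not a sub-edge of the bundle `(t, d)` reads neither the selector `(t,d,2)`,
nor the shared coin `(t,d,1)`, nor the own coins of the sub-edges: two coin samples agreeing off
these `k + 2` coins give it the same read-out. -/
theorem opn_congr_off_bundleCoins (k : ℕ) {t : Site 2} {d : Fin 2} {w : ℕ → Site 2}
    (hw₂ : ∀ v : Site 2, ax k (v, d) → tb k (v, d) = t → ∃ j, j < k ∧ v = w j)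
    {S₁ S₂ : Set (Site 2 × Fin 2 × Fin 3)}
    (h : ∀ x : Site 2 × Fin 2 × Fin 3, x ≠ (t, d, (2 : Fin 3)) → x ≠ (t, d, (1 : Fin 3)) →
      (∀ j, j < k → x ≠ (w j, d, (0 : Fin 3))) → (x ∈ S₁ ↔ x ∈ S₂))
    {vd : Site 2 × Fin 2} (hvd : ∀ j, j < k → vd ≠ (w j, d)) :
    opn k S₁ vd ↔ opn k S₂ vd := by
  obtain ⟨v, d'⟩ := vd
  have h0 : (v, d', (0 : Fin 3)) ∈ S₁ ↔ (v, d', (0 : Fin 3)) ∈ S₂ := by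
    refine h _ (by simp) (by simp) fun j hj hx => hvd j hj ?_
    simp only [Prod.mk.injEq] at hx ⊢
    exact ⟨hx.1, hx.2.1⟩
  by_cases hax : ax k (v, d')
  · have hne : (tb k (v, d'), d') ≠ (t, d) := by
      intro heq
      rw [Prod.mk.injEq] at heq
      obtain ⟨htb, rfl⟩ := heq
      obtain ⟨j, hj, rfl⟩ := hw₂ v hax htb
      exact hvd j hj rfl
    have h1 : (tb k (v, d'), d', (1 : Fin 3)) ∈ S₁ ↔ (tb k (v, d'), d', (1 : Fin 3)) ∈ S₂ := by
      refine h _ (by simp) (fun hx => hne ?_) fun j _ hx => by simp at hx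
      simp only [Prod.mk.injEq] at hx ⊢
      exact ⟨hx.1, hx.2.1⟩
    have h2 : (tb k (v, d'), d', (2 : Fin 3)) ∈ S₁ ↔ (tb k (v, d'), d', (2 : Fin 3)) ∈ S₂ := by
      refine h _ (fun hx => hne ?_) (by simp) fun j _ hx => by simp at hx
      simp only [Prod.mk.injEq] at hx ⊢
      exact ⟨hx.1, hx.2.1⟩
    simp only [opn, if_pos hax, h0, h1, h2]
  · simp only [opn, if_neg hax, h0]

/-- Hence an edge which is not a sub-edge of the bundle has the same state in the two
configurations. -/
theorem mem_cfg_iff_of_agree_off_bundleCoins (k : ℕ) {t : Site 2} {d : Fin 2} {w : ℕ → Site 2}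
    (hw₂ : ∀ v : Site 2, ax k (v, d) → tb k (v, d) = t → ∃ j, j < k ∧ v = w j)
    {S₁ S₂ : Set (Site 2 × Fin 2 × Fin 3)}
    (h : ∀ x : Site 2 × Fin 2 × Fin 3, x ≠ (t, d, (2 : Fin 3)) → x ≠ (t, d, (1 : Fin 3)) →
      (∀ j, j < k → x ≠ (w j, d, (0 : Fin 3))) → (x ∈ S₁ ↔ x ∈ S₂))
    {e : Sym2 (Site 2)} (he : ∀ j, j < k → e ≠ edgeOf (w j, d)) :
    e ∈ cfg k S₁ ↔ e ∈ cfg k S₂ := by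
  have key : ∀ (v : Site 2) (d' : Fin 2), e = edgeOf (v, d') →
      (opn k S₁ (v, d') ↔ opn k S₂ (v, d')) := by
    intro v d' hed
    refine opn_congr_off_bundleCoins k hw₂ h fun j hj hvd => he j hj ?_
    rw [hed, hvd]
  constructor
  · rintro ⟨v, d', hed, hopn⟩
    exact ⟨v, d', hed, (key v d' hed).1 hopn⟩
  · rintro ⟨v, d', hed, hopn⟩
    exact ⟨v, d', hed, (key v d' hed).2 hopn⟩

/-- A sub-edge is open iff its read-out holds (distinct representatives give distinct edges). -/
theorem edgeOf_mem_cfg_iff_opn (k : ℕ) (S : Set (Site 2 × Fin 2 × Fin 3)) (vd : Site 2 × Fin 2) :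
    edgeOf vd ∈ cfg k S ↔ opn k S vd := by
  refine ⟨?_, fun h => ⟨vd.1, vd.2, rfl, h⟩⟩
  rintro ⟨v', d', he, hopn⟩
  obtain rfl : vd = (v', d') := edgeOf_injective (a₁ := vd) (a₂ := (v', d')) he
  exact hopn

/-- **Bundle surgery.**  If `S'` agrees with `S` off the `k + 2` coins of the bundle `(t, d)` and
the sub-edge `j` reads out `p j` in `S'`, then `cfg k S'` is `cfg k S` with the bundle replaced by
the pattern `{e_j | p j}`. -/
theorem cfg_eq_of_agree_off_bundleCoins (k : ℕ) {t : Site 2} {d : Fin 2} {w : ℕ → Site 2}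
    (hw₂ : ∀ v : Site 2, ax k (v, d) → tb k (v, d) = t → ∃ j, j < k ∧ v = w j)
    (hw₃ : ∀ j j', j < k → j' < k → w j = w j' → j = j')
    {B : Finset (Sym2 (Site 2))} (hB : B = (Finset.range k).image fun j => edgeOf (w j, d))
    {S S' : Set (Site 2 × Fin 2 × Fin 3)}
    (h : ∀ x : Site 2 × Fin 2 × Fin 3, x ≠ (t, d, (2 : Fin 3)) → x ≠ (t, d, (1 : Fin 3)) →
      (∀ j, j < k → x ≠ (w j, d, (0 : Fin 3))) → (x ∈ S' ↔ x ∈ S))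
    (p : ℕ → Prop) [DecidablePred p] (hp : ∀ j, j < k → (opn k S' (w j, d) ↔ p j)) :
    cfg k S' = cfg k S \ ↑B ∪ ↑(((Finset.range k).filter p).image fun j => edgeOf (w j, d)) := by
  ext e
  by_cases he : ∃ j, j < k ∧ e = edgeOf (w j, d)
  · obtain ⟨j, hj, rfl⟩ := he
    have heB : edgeOf (w j, d) ∈ (↑B : Set (Sym2 (Site 2))) := by
      rw [hB, Finset.coe_image]
      exact ⟨j, Finset.mem_coe.2 (Finset.mem_range.2 hj), rfl⟩
    have hinj : ∀ j', j' < k → edgeOf (w j', d) = edgeOf (w j, d) → j' = j := by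
      intro j' hj' hjj'
      have h1 : (w j', d) = (w j, d) := edgeOf_injective hjj'
      rw [Prod.mk.injEq] at h1
      exact hw₃ j' j hj' hj h1.1
    rw [edgeOf_mem_cfg_iff_opn, hp j hj]
    simp only [Set.mem_union, Set.mem_sdiff, heB, not_true_eq_false, and_false, false_or,
      Finset.coe_image, Finset.coe_filter, Set.mem_image, Set.mem_setOf_eq, Finset.mem_range]
    constructor
    · exact fun hpj => ⟨j, ⟨hj, hpj⟩, rfl⟩
    · rintro ⟨j', ⟨hj', hpj'⟩, hjj'⟩
      rwa [← hinj j' hj' hjj']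
  · push Not at he
    have he' : ∀ j, j < k → e ≠ edgeOf (w j, d) := fun j hj hej => he j hj hej
    have heB : e ∉ (↑B : Set (Sym2 (Site 2))) := by
      rw [hB, Finset.coe_image]
      rintro ⟨j, hj, rfl⟩
      exact he' j (Finset.mem_range.1 (Finset.mem_coe.1 hj)) rfl
    have heI : e ∉ (↑(((Finset.range k).filter p).image fun j => edgeOf (w j, d)) :
        Set (Sym2 (Site 2))) := by
      rw [Finset.coe_image]
      rintro ⟨j, hj, rfl⟩
      exact he' j (Finset.mem_range.1 (Finset.mem_filter.1 (Finset.mem_coe.1 hj)).1) rfl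
    rw [mem_cfg_iff_of_agree_off_bundleCoins k hw₂ h he']
    simp only [Set.mem_union, Set.mem_sdiff, heB, not_false_eq_true, and_true, heI, or_false]

open Classical in
/-- **Selector ON**: every sub-edge copies the shared coin — the bundle is replaced by itself or by
nothing according to the shared coin `(t,d,1)`. -/
theorem cfg_insert_selector_eq (k : ℕ) {t : Site 2} {d : Fin 2} {w : ℕ → Site 2}
    (hw₁ : ∀ j, j < k → ax k (w j, d) ∧ tb k (w j, d) = t)
    (hw₂ : ∀ v : Site 2, ax k (v, d) → tb k (v, d) = t → ∃ j, j < k ∧ v = w j)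
    (hw₃ : ∀ j j', j < k → j' < k → w j = w j' → j = j')
    {B : Finset (Sym2 (Site 2))} (hB : B = (Finset.range k).image fun j => edgeOf (w j, d))
    (S : Set (Site 2 × Fin 2 × Fin 3)) :
    cfg k (insert (t, d, (2 : Fin 3)) S) =
      cfg k S \ ↑B ∪ (if (t, d, (1 : Fin 3)) ∈ S then (↑B : Set (Sym2 (Site 2))) else ∅) := by
  have hsh : ((t, d, (1 : Fin 3)) ∈ insert (t, d, (2 : Fin 3)) S) ↔ (t, d, (1 : Fin 3)) ∈ S := by
    simp
  have h := cfg_eq_of_agree_off_bundleCoins k hw₂ hw₃ hB (S := S) (S' := insert (t, d, (2 : Fin 3)) S)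
    (fun x hx2 _ _ => by simp [hx2]) (fun _ => (t, d, (1 : Fin 3)) ∈ S) fun j hj => by
      rw [opn_subEdge k (hw₁ j hj)]
      simp only [Set.mem_insert_iff, true_or, true_and, not_true_eq_false, false_and, or_false, hsh]
  rw [h]
  congr 1
  by_cases hS : (t, d, (1 : Fin 3)) ∈ S
  · rw [if_pos hS, Finset.filter_true_of_mem fun _ _ => hS, hB]
  · rw [if_neg hS, Finset.filter_false_of_mem fun _ _ => hS, Finset.image_empty, Finset.coe_empty]

open Classical in
/-- **Selector OFF**: every sub-edge reads its own coin — the bundle is replaced by the pattern of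
the own coins `(w j, d, 0)`. -/
theorem cfg_sdiff_selector_eq (k : ℕ) {t : Site 2} {d : Fin 2} {w : ℕ → Site 2}
    (hw₁ : ∀ j, j < k → ax k (w j, d) ∧ tb k (w j, d) = t)
    (hw₂ : ∀ v : Site 2, ax k (v, d) → tb k (v, d) = t → ∃ j, j < k ∧ v = w j)
    (hw₃ : ∀ j j', j < k → j' < k → w j = w j' → j = j')
    {B : Finset (Sym2 (Site 2))} (hB : B = (Finset.range k).image fun j => edgeOf (w j, d))
    (S : Set (Site 2 × Fin 2 × Fin 3)) :
    cfg k (S \ {(t, d, (2 : Fin 3))}) = cfg k S \ ↑B ∪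
      ↑(((Finset.range k).filter fun j => (w j, d, (0 : Fin 3)) ∈ S).image fun j => edgeOf (w j, d)) := by
  refine cfg_eq_of_agree_off_bundleCoins k hw₂ hw₃ hB (S := S) (S' := S \ {(t, d, (2 : Fin 3))})
    (fun x hx2 _ _ => by simp [hx2]) (fun j => (w j, d, (0 : Fin 3)) ∈ S) fun j hj => ?_
  rw [opn_subEdge k (hw₁ j hj)]
  have h2 : ((w j, d, (0 : Fin 3)) : Site 2 × Fin 2 × Fin 3) ≠ (t, d, (2 : Fin 3)) := by simp
  simp [h2]

/-- The Finset of sub-edges IS the bundle: the axial edges of direction `d` with coarse base `t`. -/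
theorem coe_bundleFinset_eq_image (k : ℕ) {t : Site 2} {d : Fin 2} {w : ℕ → Site 2}
    (hw₁ : ∀ j, j < k → ax k (w j, d) ∧ tb k (w j, d) = t)
    (hw₂ : ∀ v : Site 2, ax k (v, d) → tb k (v, d) = t → ∃ j, j < k ∧ v = w j)
    {B : Finset (Sym2 (Site 2))} (hB : B = (Finset.range k).image fun j => edgeOf (w j, d)) :
    (↑B : Set (Sym2 (Site 2))) = edgeOf '' {vd : Site 2 × Fin 2 | ax k vd ∧ tb k vd = t ∧ vd.2 = d} := by
  rw [hB, Finset.coe_image]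
  ext e
  constructor
  · rintro ⟨j, hj, rfl⟩
    have hj' := Finset.mem_range.1 (Finset.mem_coe.1 hj)
    exact ⟨(w j, d), ⟨(hw₁ j hj').1, (hw₁ j hj').2, rfl⟩, rfl⟩
  · rintro ⟨⟨v, d'⟩, ⟨hax, htb, hd⟩, rfl⟩
    simp only at hd
    subst hd
    obtain ⟨j, hj, rfl⟩ := hw₂ v hax htb
    exact ⟨j, Finset.mem_coe.2 (Finset.mem_range.2 hj), rfl⟩

/-! ## The sections of `Aloc` at a bundle pattern: coin-side bookkeeping -/

/-- Replacing a fixed edge set by a fixed pattern is a measurable self-map of configurations. -/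
theorem measurable_sdiff_union_const {α : Type*} (D I : Set α) : Measurable fun ω : Set α => ω \ D ∪ I :=
  measurable_set_iff.2 fun x => ((measurable_set_mem x).and measurable_const).or measurable_const

/-- The section `A^C = {ω | (ω ∖ B) ∪ C ∈ Aloc}` is measurable (`η ≠ 0`). -/
theorem measurableSet_section_bundle (m : ℕ) (F : Fin m → Quad (Set.univ : Set ℂ)) {η : ℝ} (hη : η ≠ 0)
    (B C : Set (Sym2 (Site 2))) : MeasurableSet {ω : BondConfig (Site 2) | ω \ B ∪ C ∈ Aloc m F η} :=
  measurable_sdiff_union_const B C (measurableSet_Aloc m F hη)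

/-- The pulled-back section `{S | (cfg k S ∖ B) ∪ C ∈ Aloc}` ignores the `k + 2` coins of the
bundle: it is determined by their complement. -/
theorem determinedBy_preimage_section_bundle (k m : ℕ) (F : Fin m → Quad (Set.univ : Set ℂ)) (η : ℝ)
    {t : Site 2} {d : Fin 2} {w : ℕ → Site 2}
    (hw₂ : ∀ v : Site 2, ax k (v, d) → tb k (v, d) = t → ∃ j, j < k ∧ v = w j)
    {B : Finset (Sym2 (Site 2))} (hB : B = (Finset.range k).image fun j => edgeOf (w j, d))
    (C : Set (Sym2 (Site 2))) :
    DeterminedBy {S : Set (Site 2 × Fin 2 × Fin 3) | cfg k S \ ↑B ∪ C ∈ Aloc m F η}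
      (↑(insert (t, d, (2 : Fin 3)) (insert (t, d, (1 : Fin 3))
        ((Finset.range k).image fun j => (w j, d, (0 : Fin 3))))) : Set (Site 2 × Fin 2 × Fin 3))ᶜ := by
  rw [determinedBy_iff]
  intro S₁ S₂ hS
  have hagree : ∀ x : Site 2 × Fin 2 × Fin 3, x ≠ (t, d, (2 : Fin 3)) → x ≠ (t, d, (1 : Fin 3)) →
      (∀ j, j < k → x ≠ (w j, d, (0 : Fin 3))) → (x ∈ S₁ ↔ x ∈ S₂) := by
    intro x hx2 hx1 hx0
    have hx : x ∈ (↑(insert (t, d, (2 : Fin 3)) (insert (t, d, (1 : Fin 3))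
        ((Finset.range k).image fun j => (w j, d, (0 : Fin 3))))) : Set (Site 2 × Fin 2 × Fin 3))ᶜ := by
      simp only [Finset.coe_insert, Finset.coe_image, Finset.coe_range, Set.mem_compl_iff,
        Set.mem_insert_iff, Set.mem_image, Set.mem_Iio, not_or, not_exists, not_and]
      exact ⟨hx2, hx1, fun j hj hjx => hx0 j hj hjx.symm⟩
    exact ⟨fun h1 => ((Set.ext_iff.1 hS x).1 ⟨h1, hx⟩).1, fun h2 => ((Set.ext_iff.1 hS x).2 ⟨h2, hx⟩).1⟩
  have hcfg : cfg k S₁ \ ↑B = cfg k S₂ \ ↑B := by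
    ext e
    simp only [Set.mem_sdiff]
    by_cases heB : e ∈ (↑B : Set (Sym2 (Site 2)))
    · simp [heB]
    · have he' : ∀ j, j < k → e ≠ edgeOf (w j, d) := by
        rintro j hj rfl
        refine heB ?_
        rw [hB, Finset.coe_image]
        exact ⟨j, Finset.mem_coe.2 (Finset.mem_range.2 hj), rfl⟩
      rw [mem_cfg_iff_of_agree_off_bundleCoins k hw₂ hagree he']
  simp only [Set.mem_setOf_eq, hcfg]

/-- The pulled-back section has the `M_k(ρ,c)`-probability of the section. -/
theorem real_preimage_section_bundle (k m : ℕ) (F : Fin m → Quad (Set.univ : Set ℂ)) {η : ℝ}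
    (hη : η ≠ 0) (ρ c : ℝ) (B C : Set (Sym2 (Site 2))) :
    (prodBernoulli (prm k ρ c)).real {S : Set (Site 2 × Fin 2 × Fin 3) | cfg k S \ B ∪ C ∈ Aloc m F η} =
      (M k ρ c).real {ω | ω \ B ∪ C ∈ Aloc m F η} :=
  (map_measureReal_apply (measurable_cfg k) (measurableSet_section_bundle m F hη B C)).symm

/-! ## The two Russo terms of a selector -/

/-- **Selector forced ON**: `P{S | σ ∪ S ∈ E} = ½ M(ω ∪ B ∈ Aloc) + ½ M(ω ∖ B ∈ Aloc)`
(condition on the fair shared coin, independent of the section events). -/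
theorem real_insert_selector_eq_sections : ∀ (k m : ℕ) (F : Fin m → Quad (Set.univ : Set ℂ)) {η : ℝ}, η ≠ 0 → ∀ {t : Site 2} {d : Fin 2} {w : ℕ → Site 2}, (∀ j, j < k → ax k (w j, d) ∧ tb k (w j, d) = t) → (∀ v : Site 2, ax k (v, d) → tb k (v, d) = t → ∃ j, j < k ∧ v = w j) → (∀ j j', j < k → j' < k → w j = w j' → j = j') → ∀ {B : Finset (Sym2 (Site 2))}, (B = (Finset.range k).image fun j => edgeOf (w j, d)) → ∀ ρ c : ℝ, (prodBernoulli (prm k ρ c)).real {S | insert (t, d, (2 : Fin 3)) S ∈ (cfg k) ⁻¹' Aloc m F η} = 1 / 2 * (M k ρ c).real {ω | ω ∪ ↑B ∈ Aloc m F η} + 1 / 2 * (M k ρ c).real {ω | ω \ ↑B ∈ Aloc m F η} := by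
  intro k m F η hη t d w hw₁ hw₂ hw₃ B hB ρ c
  classical
  set μ := prodBernoulli (prm k ρ c) with hμ
  set sh : Site 2 × Fin 2 × Fin 3 := (t, d, (1 : Fin 3)) with hsh
  set X : Set (Sym2 (Site 2)) → Set (Set (Site 2 × Fin 2 × Fin 3)) :=
    fun C => {S | cfg k S \ ↑B ∪ C ∈ Aloc m F η} with hX
  have hXm : ∀ C, MeasurableSet (X C) := fun C =>
    measurable_cfg k (measurableSet_section_bundle m F hη ↑B C)
  have hXdet : ∀ C, DeterminedBy (X C) (↑({sh} : Finset (Site 2 × Fin 2 × Fin 3)) : Set _)ᶜ := by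
    intro C
    refine (determinedBy_preimage_section_bundle k m F η hw₂ hB C).mono ?_
    refine Set.compl_subset_compl.2 ?_
    simp [hsh]
  have hset : {S : Set (Site 2 × Fin 2 × Fin 3) | insert (t, d, (2 : Fin 3)) S ∈ (cfg k) ⁻¹' Aloc m F η} =
      ({S | sh ∈ S} ∩ X ↑B) ∪ ({S | sh ∉ S} ∩ X ∅) := by
    ext S
    simp only [Set.mem_setOf_eq, Set.mem_preimage, cfg_insert_selector_eq k hw₁ hw₂ hw₃ hB S,
      Set.mem_union, Set.mem_inter_iff, hX, hsh]
    by_cases hS : (t, d, (1 : Fin 3)) ∈ S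
    · simp [hS]
    · simp [hS]
  have hdisj : Disjoint ({S | sh ∈ S} ∩ X ↑B) ({S | sh ∉ S} ∩ X ∅) :=
    Set.disjoint_left.2 fun S h1 h2 => h2.1 h1.1
  have hAm : MeasurableSet {S : Set (Site 2 × Fin 2 × Fin 3) | sh ∈ S} := (measurable_set_mem sh).setOf
  have hAcm : MeasurableSet {S : Set (Site 2 × Fin 2 × Fin 3) | sh ∉ S} := hAm.compl
  have hAdet : DeterminedBy {S : Set (Site 2 × Fin 2 × Fin 3) | sh ∈ S}
      (↑({sh} : Finset (Site 2 × Fin 2 × Fin 3)) : Set _) := by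
    rw [determinedBy_iff]
    intro S₁ S₂ hS
    have hx : sh ∈ (↑({sh} : Finset (Site 2 × Fin 2 × Fin 3)) : Set _) := by simp
    exact ⟨fun h1 => ((Set.ext_iff.1 hS sh).1 ⟨h1, hx⟩).1, fun h2 => ((Set.ext_iff.1 hS sh).2 ⟨h2, hx⟩).1⟩
  have hAcdet : DeterminedBy {S : Set (Site 2 × Fin 2 × Fin 3) | sh ∉ S}
      (↑({sh} : Finset (Site 2 × Fin 2 × Fin 3)) : Set _) := by
    rw [determinedBy_iff] at hAdet ⊢
    intro S₁ S₂ hS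
    show (sh ∉ S₁) ↔ (sh ∉ S₂)
    exact not_congr (hAdet S₁ S₂ hS)
  have hp1 : (prm k ρ c sh : ℝ) = 1 / 2 := by simp [hsh, prm]
  have hA : μ.real {S | sh ∈ S} = 1 / 2 := by rw [hμ, prodBernoulli_real_setOf_mem, hp1]
  have hAc : μ.real {S | sh ∉ S} = 1 / 2 := by
    rw [hμ, prodBernoulli_real_setOf_notMem, hp1]; norm_num
  rw [hset, measureReal_union hdisj (hAcm.inter (hXm _)),
    prodBernoulli_real_inter_of_determinedBy _ {sh} hAdet (hXdet _) hAm (hXm _),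
    prodBernoulli_real_inter_of_determinedBy _ {sh} hAcdet (hXdet _) hAcm (hXm _), hA, hAc]
  simp only [hX]
  rw [real_preimage_section_bundle k m F hη ρ c, real_preimage_section_bundle k m F hη ρ c]
  simp only [Set.sdiff_union_self, Set.union_empty]

end Summit.CriticalPhenomena.CardyFormulaZ2.Theorems.CardySelfRefinement

end
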